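import Literature.Topology.FourManifolds.MapSmoothing
import Mathlib.Analysis.SpecialFunctions.SmoothTransition
import HarnessLib

/-!
# Smoothing a homotopy of arcs relative to its ends and to the end pieces of the arcs

Topic `Literature/Topology/FourManifolds`; the smoothing step of the proof of
`Literature.Topology.FourManifolds.arcs_ambientIsotopic_rel_of_homotopicRel`
(`OneHandleUniqueness.lean`: arcs homotopic rel ends are ambient isotopic rel ends — Whitney
(1936), §II Thm. 6, whose proof, §8, begins by making the homotopy differentiable; Milnor (1965),
Thm. 8.4; Hirsch (1976), Ch. 8 §1).  One arc at a time:

* `exists_contMDiff_homotopy_arc_rel` — let `a₀ a₁ : ℝ → X` be smooth on an open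
  `W ⊇ [-1 - 2θ, 1 + 2θ]` and equal for `|t| > 1 - η`, and let `H : ℝ × ℝ → X` be a continuous
  homotopy with `H (0, ·) = a₀`, `H (1, ·) = a₁` on `[-1, 1]`, stationary (`= a₀`) for
  `1 - η ≤ |t| ≤ 1`, whose moving part misses the closed set `Z`, as does `a₀` on
  `|t| ≤ 1 - η + 4ε` (`4ε < η`).  Then there is a **smooth** `g : ℝ × ℝ → X` with
  `g (s, ·) = a₀` for `s ≤ 1/4` and `g (s, ·) = a₁` for `s ≥ 3/4` (on `|t| ≤ 1 + θ`),
  `g (s, t) = a₀ t` on the band `1 - η + ε ≤ |t| ≤ 1 + θ` for all `s`, and `g (s, t) ∉ Z` for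
  `s ∈ [0, 1]`, `|t| ≤ 1 - η + 3ε`.

Proof: reparametrise the time by a smooth `σ` (`= 0` for `s ≤ 3/8`, `= 1` for `s ≥ 5/8`) and
continue the stages beyond `[-1, 1]` by `a₀` (clamped into `W`) to get a continuous
`h : ℝ × ℝ → X` which is already smooth near the closed set where the conclusions are claimed;
then apply the tree's relative smoothing with open constraints
`exists_contMDiff_eqOn_mapsTo` (`MapSmoothing.lean`: Hirsch, Ch. 2 §2 Thm. 2.6) with the single
constraint "`[0, 1] × {|t| ≤ 1 - η + 3ε}` is mapped into `X ∖ Z`".  Everything here is proved;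
no definitions, no named facts.

## References

* H. Whitney, *Differentiable manifolds*, Ann. of Math. (2) 37 (1936), 645–680, §II Thm. 6, §8.
  [Whitney1936]
* M. W. Hirsch, *Differential Topology*, GTM 33 (1976), Ch. 2 §2 Thm. 2.6; Ch. 8 §1.
  [HirschDT1976]
* J. Milnor, *Lectures on the h-cobordism theorem* (1965), Thm. 8.4 and Remark (PDF p. 56).
  [MilnorHCobordism1965]
-/

open scoped Manifold ContDiff Topology
open Set Function Filter

noncomputable section

namespace Literature.Topology.FourManifolds

variable {d : ℕ} {X : Type*} [TopologicalSpace X] [T2Space X] [CompactSpace X]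
  [ChartedSpace (EuclideanSpace ℝ (Fin d)) X] [IsManifold (𝓡 d) ∞ X]

/-- **Smoothing a homotopy of arcs rel ends and rel the end pieces** (Whitney (1936), §8, first
step of the proof of §II Thm. 6: the homotopy is made differentiable; here with Hirsch's relative
approximation theorem, Ch. 2 §2 Thm. 2.6).  Hypotheses: `a₀ a₁ : ℝ → X` smooth on an open
`W ⊇ [-1 - 2θ, 1 + 2θ]`, equal for `|t| > 1 - η` (`t ∈ W`); `H : ℝ × ℝ → X` continuous with
`H (0, t) = a₀ t`, `H (1, t) = a₁ t` for `t ∈ [-1, 1]`, `H (s, t) = a₀ t` for `s ∈ [0, 1]`,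
`t ∈ [-1, 1]`, `1 - η ≤ |t|`; `Z` closed, missed by `H (s, t)` for `s ∈ [0, 1]`, `|t| ≤ 1 - η`
(`t ∈ [-1, 1]`) and by `a₀ t` for `|t| ≤ 1 - η + 4ε`; `0 < ε`, `4ε < η`, `0 < θ`.  Conclusion: a
smooth `g : ℝ × ℝ → X` with `g (s, t) = a₀ t` for `s ≤ 1/4`, `g (s, t) = a₁ t` for `s ≥ 3/4`
(both for `|t| ≤ 1 + θ`), `g (s, t) = a₀ t` whenever `1 - η + ε ≤ |t| ≤ 1 + θ`, and
`g (s, t) ∉ Z` for `s ∈ [0, 1]`, `|t| ≤ 1 - η + 3ε`. [cite: Whitney1936, §II Thm. 6 and §8]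
[cite: HirschDT1976, Ch. 2 §2 Thm. 2.6] -/
theorem exists_contMDiff_homotopy_arc_rel
    {a₀ a₁ : ℝ → X} {H : ℝ × ℝ → X} {Z : Set X} {W : Set ℝ} {η θ ε : ℝ}
    (hθ : 0 < θ) (hε : 0 < ε) (hεη : 4 * ε < η)
    (hW : IsOpen W) (hWI : Icc (-1 - 2 * θ) (1 + 2 * θ) ⊆ W)
    (ha₀ : ContMDiffOn 𝓘(ℝ, ℝ) (𝓡 d) ∞ a₀ W) (ha₁ : ContMDiffOn 𝓘(ℝ, ℝ) (𝓡 d) ∞ a₁ W)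
    (hends : ∀ t ∈ W, 1 - η < |t| → a₀ t = a₁ t)
    (hH : Continuous H)
    (hH01 : ∀ t ∈ Icc (-1 : ℝ) 1, H (0, t) = a₀ t ∧ H (1, t) = a₁ t)
    (hstat : ∀ s ∈ Icc (0 : ℝ) 1, ∀ t ∈ Icc (-1 : ℝ) 1, 1 - η ≤ |t| → H (s, t) = a₀ t)
    (hZ : IsClosed Z)
    (hHZ : ∀ s ∈ Icc (0 : ℝ) 1, ∀ t ∈ Icc (-1 : ℝ) 1, |t| ≤ 1 - η → H (s, t) ∉ Z)
    (haZ : ∀ t, |t| ≤ 1 - η + 4 * ε → a₀ t ∉ Z) :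
    ∃ g : ℝ × ℝ → X, ContMDiff 𝓘(ℝ, ℝ × ℝ) (𝓡 d) ∞ g ∧
      (∀ s t, s ≤ 1 / 4 → |t| ≤ 1 + θ → g (s, t) = a₀ t) ∧
      (∀ s t, 3 / 4 ≤ s → |t| ≤ 1 + θ → g (s, t) = a₁ t) ∧
      (∀ s t, 1 - η + ε ≤ |t| → |t| ≤ 1 + θ → g (s, t) = a₀ t) ∧
      ∀ s ∈ Icc (0 : ℝ) 1, ∀ t, |t| ≤ 1 - η + 3 * ε → g (s, t) ∉ Z := by
  classical
  -- ### the time reparametrisation `σ` and the clamp `κ`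
  set σ : ℝ → ℝ := fun s => Real.smoothTransition (4 * s - 3 / 2) with hσ
  have hσs : ContDiff ℝ ∞ σ :=
    Real.smoothTransition.contDiff.comp ((contDiff_const.mul contDiff_id).sub contDiff_const)
  have hσ01 : ∀ s, σ s ∈ Icc (0 : ℝ) 1 := fun s =>
    ⟨Real.smoothTransition.nonneg _, Real.smoothTransition.le_one _⟩
  have hσ0 : ∀ s, s < 3 / 8 → σ s = 0 := fun s hs =>
    Real.smoothTransition.zero_of_nonpos (by linarith)
  have hσ1 : ∀ s, 5 / 8 < s → σ s = 1 := fun s hs =>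
    Real.smoothTransition.one_of_one_le (by linarith)
  set κ : ℝ → ℝ := fun t => max (-(1 + 2 * θ)) (min t (1 + 2 * θ)) with hκ
  have hκc : Continuous κ := continuous_const.max (continuous_id.min continuous_const)
  have hκW : ∀ t, κ t ∈ W := fun t => by
    refine hWI ⟨?_, ?_⟩
    · have : -(1 + 2 * θ) ≤ κ t := le_max_left _ _
      linarith
    · exact max_le (by linarith) (min_le_right _ _)
  have hκid : ∀ t, |t| < 1 + 2 * θ → κ t = t := fun t ht => by
    obtain ⟨h1, h2⟩ := abs_lt.1 ht
    simp only [hκ]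
    rw [min_eq_left h2.le, max_eq_right h1.le]
  have htW : ∀ t, |t| < 1 + 2 * θ → t ∈ W := fun t ht => by
    obtain ⟨h1, h2⟩ := abs_lt.1 ht
    exact hWI ⟨by linarith, h2.le⟩
  have habs1 : ∀ t : ℝ, |t| ≤ 1 → t ∈ Icc (-1 : ℝ) 1 := fun t ht => abs_le.1 ht
  -- ### the continuous map `h`, already smooth near the ends and near the end pieces
  set h : ℝ × ℝ → X := fun p => if |p.2| ≤ 1 then H (σ p.1, p.2) else a₀ (κ p.2) with hh
  have hbr₁ : Continuous fun p : ℝ × ℝ => H (σ p.1, p.2) :=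
    hH.comp ((hσs.continuous.comp continuous_fst).prodMk continuous_snd)
  have hbr₂ : Continuous fun p : ℝ × ℝ => a₀ (κ p.2) :=
    ha₀.continuousOn.comp_continuous (hκc.comp continuous_snd) fun p => hκW _
  have hcont : Continuous h := by
    refine Continuous.if_le hbr₁ hbr₂ (continuous_abs.comp continuous_snd) continuous_const
      fun p hp => ?_
    have hp1 : p.2 ∈ Icc (-1 : ℝ) 1 := habs1 _ hp.le
    rw [hstat (σ p.1) (hσ01 _) p.2 hp1 (by linarith), hκid _ (by linarith)]
  -- pointwise identities on the three open pieces
  have hUa : ∀ p : ℝ × ℝ, p.1 < 3 / 8 → |p.2| < 1 + 2 * θ → h p = a₀ p.2 := by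
    intro p hs ht
    by_cases h1 : |p.2| ≤ 1
    · have : h p = H (σ p.1, p.2) := if_pos h1
      rw [this, hσ0 _ hs]
      exact (hH01 _ (habs1 _ h1)).1
    · have : h p = a₀ (κ p.2) := if_neg h1
      rw [this, hκid _ ht]
  have hUb : ∀ p : ℝ × ℝ, 5 / 8 < p.1 → |p.2| < 1 + 2 * θ → h p = a₁ p.2 := by
    intro p hs ht
    by_cases h1 : |p.2| ≤ 1
    · have : h p = H (σ p.1, p.2) := if_pos h1
      rw [this, hσ1 _ hs]
      exact (hH01 _ (habs1 _ h1)).2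
    · have : h p = a₀ (κ p.2) := if_neg h1
      rw [this, hκid _ ht]
      exact hends _ (htW _ ht) (by linarith [not_le.1 h1])
  have hUc : ∀ p : ℝ × ℝ, 1 - η < |p.2| → |p.2| < 1 + 2 * θ → h p = a₀ p.2 := by
    intro p hs ht
    by_cases h1 : |p.2| ≤ 1
    · have : h p = H (σ p.1, p.2) := if_pos h1
      rw [this]
      exact hstat _ (hσ01 _) _ (habs1 _ h1) hs.le
    · have : h p = a₀ (κ p.2) := if_neg h1
      rw [this, hκid _ ht]
  -- smoothness of `a₀ ∘ pr₂`, `a₁ ∘ pr₂` at points over `W`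
  have hsnd : ContMDiff 𝓘(ℝ, ℝ × ℝ) 𝓘(ℝ, ℝ) ∞ (Prod.snd : ℝ × ℝ → ℝ) := contDiff_snd.contMDiff
  have hA₀ : ∀ p : ℝ × ℝ, |p.2| < 1 + 2 * θ →
      ContMDiffAt 𝓘(ℝ, ℝ × ℝ) (𝓡 d) ∞ (fun q : ℝ × ℝ => a₀ q.2) p := fun p hp =>
    ((ha₀ _ (htW _ hp)).contMDiffAt (hW.mem_nhds (htW _ hp))).comp p (hsnd p)
  have hA₁ : ∀ p : ℝ × ℝ, |p.2| < 1 + 2 * θ →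
      ContMDiffAt 𝓘(ℝ, ℝ × ℝ) (𝓡 d) ∞ (fun q : ℝ × ℝ => a₁ q.2) p := fun p hp =>
    ((ha₁ _ (htW _ hp)).contMDiffAt (hW.mem_nhds (htW _ hp))).comp p (hsnd p)
  -- ### the open set `Ω` where `h` is smooth and the closed set `S ⊆ Ω`
  set Ω : Set (ℝ × ℝ) := {p | (p.1 < 3 / 8 ∧ |p.2| < 1 + 2 * θ) ∨ (5 / 8 < p.1 ∧ |p.2| < 1 + 2 * θ) ∨
    (1 - η < |p.2| ∧ |p.2| < 1 + 2 * θ)} with hΩ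
  have habsc : Continuous fun p : ℝ × ℝ => |p.2| := continuous_abs.comp continuous_snd
  have hΩo : IsOpen Ω := by
    refine ((isOpen_lt continuous_fst continuous_const).inter
      (isOpen_lt habsc continuous_const)).union
      (((isOpen_lt continuous_const continuous_fst).inter (isOpen_lt habsc continuous_const)).union
      ((isOpen_lt continuous_const habsc).inter (isOpen_lt habsc continuous_const)))
  have hΩs : ContMDiffOn 𝓘(ℝ, ℝ × ℝ) (𝓡 d) ∞ h Ω := by
    intro p hp
    refine ContMDiffAt.contMDiffWithinAt ?_
    rcases hp with ⟨hs, ht⟩ | ⟨hs, ht⟩ | ⟨hs, ht⟩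
    · have hev : h =ᶠ[𝓝 p] fun q : ℝ × ℝ => a₀ q.2 := by
        filter_upwards [((isOpen_lt continuous_fst continuous_const).inter
          (isOpen_lt habsc continuous_const)).mem_nhds ⟨hs, ht⟩] with q hq using hUa q hq.1 hq.2
      exact (hA₀ p ht).congr_of_eventuallyEq hev
    · have hev : h =ᶠ[𝓝 p] fun q : ℝ × ℝ => a₁ q.2 := by
        filter_upwards [((isOpen_lt continuous_const continuous_fst).inter
          (isOpen_lt habsc continuous_const)).mem_nhds ⟨hs, ht⟩] with q hq using hUb q hq.1 hq.2
      exact (hA₁ p ht).congr_of_eventuallyEq hev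
    · have hev : h =ᶠ[𝓝 p] fun q : ℝ × ℝ => a₀ q.2 := by
        filter_upwards [((isOpen_lt continuous_const habsc).inter
          (isOpen_lt habsc continuous_const)).mem_nhds ⟨hs, ht⟩] with q hq using hUc q hq.1 hq.2
      exact (hA₀ p ht).congr_of_eventuallyEq hev
  set S : Set (ℝ × ℝ) := {p | (p.1 ≤ 1 / 4 ∨ 3 / 4 ≤ p.1) ∧ |p.2| ≤ 1 + θ} ∪
    {p | 1 - η + ε ≤ |p.2| ∧ |p.2| ≤ 1 + θ} with hS
  have hSc : IsClosed S := by
    refine (((isClosed_le continuous_fst continuous_const).union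
      (isClosed_le continuous_const continuous_fst)).inter (isClosed_le habsc continuous_const)).union
      ((isClosed_le continuous_const habsc).inter (isClosed_le habsc continuous_const))
  have hSΩ : S ⊆ Ω := by
    rintro p (⟨hs | hs, ht⟩ | ⟨hs, ht⟩)
    · exact Or.inl ⟨by linarith, by linarith⟩
    · exact Or.inr (Or.inl ⟨by linarith, by linarith⟩)
    · exact Or.inr (Or.inr ⟨by linarith, by linarith⟩)
  -- ### the constraint: `[0, 1] × [-(1 - η + 3ε), 1 - η + 3ε]` is mapped off `Z`
  set C : Unit → Set (ℝ × ℝ) := fun _ => Icc (0 : ℝ) 1 ×ˢ Icc (-(1 - η + 3 * ε)) (1 - η + 3 * ε)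
    with hC
  have hCc : ∀ i, IsCompact (C i) := fun _ => isCompact_Icc.prod isCompact_Icc
  have hCU : ∀ i, MapsTo h (C i) Zᶜ := by
    rintro - ⟨s, t⟩ ⟨hs, ht⟩
    have ht' : |t| ≤ 1 - η + 3 * ε := abs_le.2 ht
    have ht1 : |t| ≤ 1 := by linarith
    have hval : h (s, t) = H (σ s, t) := if_pos ht1
    rw [mem_compl_iff, hval]
    by_cases hmid : |t| ≤ 1 - η
    · exact hHZ _ (hσ01 s) _ (habs1 _ ht1) hmid
    · rw [hstat _ (hσ01 s) _ (habs1 _ ht1) (le_of_lt (not_le.1 hmid))]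
      exact haZ _ (by linarith)
  -- ### smoothing
  obtain ⟨g, hgs, hgS, hgC⟩ := exists_contMDiff_eqOn_mapsTo (IM := 𝓘(ℝ, ℝ × ℝ)) hcont hSc hΩo hSΩ
    hΩs hCc (fun _ => hZ.isOpen_compl) hCU
  refine ⟨g, hgs, fun s t hs ht => ?_, fun s t hs ht => ?_, fun s t h1 h2 => ?_, fun s hs t ht => ?_⟩
  · rw [hgS (Or.inl ⟨Or.inl hs, ht⟩)]
    exact hUa (s, t) (by change s < 3 / 8; linarith) (by change |t| < 1 + 2 * θ; linarith)
  · rw [hgS (Or.inl ⟨Or.inr hs, ht⟩)]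
    exact hUb (s, t) (by change 5 / 8 < s; linarith) (by change |t| < 1 + 2 * θ; linarith)
  · rw [hgS (Or.inr ⟨h1, h2⟩)]
    exact hUc (s, t) (by change 1 - η < |t|; linarith) (by change |t| < 1 + 2 * θ; linarith)
  · exact hgC () ⟨hs, abs_le.1 ht⟩

end Literature.Topology.FourManifolds
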